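import Literature.MathematicalPhysics.QuantumLattice.FinDimSpectrumClusterGapProofs
import HarnessLib

/-!
# The inertia of a continuous family of nonsingular Hermitian matrices is constant on connected sets

Topic `Literature/LinearAlgebra/Matrix`. A continuity lemma of parametric stability analysis (the
«boundary-crossing» principle read for Hermitian matrices): if `x ↦ G(x)` is a continuous family of
Hermitian matrices on a preconnected parameter set `S` and no `G(x)`, `x ∈ S`, has the eigenvalue `0`,
then the numbers of positive and of negative eigenvalues of `G(x)` (with multiplicity, Mathlib's
`Matrix.IsHermitian.eigenvalues`) do not depend on `x ∈ S`.

THE ARGUMENT (elementary, no continuity of the ordered eigenvalues is used). LOWER SEMICONTINUITY of the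
positive count (`eventually_card_pos_eigenvalues_le`): at `x₀` let `E₊` be the span of the eigenvectors
with positive eigenvalues, `c > 0` the least of them; on `E₊` the form of `G(x₀)` is `≥ c‖v‖²`
(`mul_norm_sq_le_re_inner_of_mem_eigSpan` of `FinDimSpectrumClusterGapProofs.lean`), and
`|re⟪v, (G(y) − G(x₀))v⟫| ≤ ‖G(y) − G(x₀)‖·‖v‖²` with the operator norm, which is `< c/2` for `y` near
`x₀`; so the form of `G(y)` is positive on `E₊ ∖ {0}` and the counting form of Courant–Fischer
(`finrank_le_card_lt_eigenvalues`) gives `ν₊(G(y)) ≥ dim E₊ = ν₊(G(x₀))`. The same for `ν₋`. With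
`ν₊ + ν₋ = n` on `S` (no zero eigenvalue) both counts are locally constant on `S`, hence constant
(`IsPreconnected.constant`).

USE (certnum eigen-margin line, `ParametricLyapunovTaylorCertificate.lean` «inertia leaves»): with
`G = −P(δ)` and the Carlson–Schneider Main Inertia Theorem, a Lyapunov-form certificate `Q(δ) ≻ O` on a
leaf box makes `G(δ)` nonsingular on the (convex) leaf, so the eigenvalue counts of `J(x)` in the open
half-planes are constant on the leaf and need to be certified AT THE CENTRE ONLY (exact data, no interval
radius) — the inertia analogue of `LyapunovConnectedFamily.posDef_on_of_lyapunov_pos`.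

## References

* [GolubVanLoan2013] G. H. Golub, C. F. Van Loan, *Matrix Computations*, 4th ed., §8.1.1 Thm 8.1.2
  (Courant–Fischer Minimax Theorem; the counting form used here).
  [cite: GolubVanLoan2013, §8.1.1 Thm 8.1.2 (Courant–Fischer Minimax Theorem)]
* [CarlsonSchneider1962] D. Carlson, H. Schneider, *Inertia theorems for matrices: the semi-definite case*,
  Bull. Amer. Math. Soc. 68 (1962) 479–484, § 1 — the inertia triple `(π, ν, δ)`; the continuity argument is
  folklore of parametric robust stability. [cite: CarlsonSchneider1962, § 1]
-/

open Matrix Finset Module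
open scoped InnerProductSpace ComplexOrder

namespace Literature.LinearAlgebra.Matrix

open Literature.MathematicalPhysics.QuantumLattice

variable {X : Type*} [TopologicalSpace X] {m : Type*} [Fintype m] [DecidableEq m]

omit [DecidableEq m] in
/-- The operator norm controls the real part of the form: `|re⟪v, Tv⟫| ≤ ‖T‖·‖v‖²`. [folklore] -/
private theorem abs_re_inner_le_opNorm_mul (T : EuclideanSpace ℂ m →L[ℂ] EuclideanSpace ℂ m)
    (v : EuclideanSpace ℂ m) : |RCLike.re ⟪v, T v⟫_ℂ| ≤ ‖T‖ * ‖v‖ ^ 2 := by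
  calc |RCLike.re ⟪v, T v⟫_ℂ| ≤ ‖⟪v, T v⟫_ℂ‖ := RCLike.abs_re_le_norm _
    _ ≤ ‖v‖ * ‖T v‖ := norm_inner_le_norm _ _
    _ ≤ ‖v‖ * (‖T‖ * ‖v‖) := by gcongr; exact T.le_opNorm v
    _ = ‖T‖ * ‖v‖ ^ 2 := by ring

/-- For a continuous matrix family, the operator `G(y) − G(x₀)` is eventually small in operator norm.
[folklore] -/
private theorem eventually_opNorm_sub_lt {G : X → Matrix m m ℂ} (hG : Continuous G) (x₀ : X) {ε : ℝ}
    (hε : 0 < ε) :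
    ∀ᶠ y in nhds x₀, ‖Matrix.toEuclideanCLM (n := m) (𝕜 := ℂ) (G y - G x₀)‖ < ε := by
  have hc : Continuous fun M : Matrix m m ℂ ↦ Matrix.toEuclideanCLM (n := m) (𝕜 := ℂ) M :=
    LinearMap.continuous_of_finiteDimensional (Matrix.toEuclideanCLM (n := m) (𝕜 := ℂ)).toAlgEquiv.toLinearMap
  have hg : Continuous fun y ↦ ‖Matrix.toEuclideanCLM (n := m) (𝕜 := ℂ) (G y - G x₀)‖ :=
    continuous_norm.comp (hc.comp (hG.sub continuous_const))
  have h0 : (fun y ↦ ‖Matrix.toEuclideanCLM (n := m) (𝕜 := ℂ) (G y - G x₀)‖) x₀ < (fun _ ↦ ε) x₀ := by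
    simp [hε]
  exact hg.continuousAt.eventually_lt continuousAt_const h0

/-- The form splits: `re⟪v, G(y)v⟫ = re⟪v, G(x₀)v⟫ + re⟪v, (G(y) − G(x₀))v⟫`, the second summand
read through `toEuclideanCLM`. [folklore] -/
private theorem re_inner_split (A B : Matrix m m ℂ) (v : EuclideanSpace ℂ m) :
    RCLike.re ⟪v, toEuclideanLin B v⟫_ℂ
      = RCLike.re ⟪v, toEuclideanLin A v⟫_ℂ
        + RCLike.re ⟪v, (Matrix.toEuclideanCLM (n := m) (𝕜 := ℂ) (B - A)) v⟫_ℂ := by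
  have h1 : (Matrix.toEuclideanCLM (n := m) (𝕜 := ℂ) (B - A)) v = toEuclideanLin (B - A) v := rfl
  rw [h1, map_sub, LinearMap.sub_apply, inner_sub_right, map_sub]
  ring

/-- **Lower semicontinuity of the positive count.** For a continuous family of Hermitian matrices,
`ν₊(G(x₀)) ≤ ν₊(G(y))` for all `y` near `x₀`. [cite: GolubVanLoan2013, §8.1.1 Thm 8.1.2 (Courant–Fischer Minimax Theorem)] -/
theorem eventually_card_pos_eigenvalues_le {G : X → Matrix m m ℂ} (hG : Continuous G)
    (hH : ∀ x, (G x).IsHermitian) (x₀ : X) :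
    ∀ᶠ y in nhds x₀, #{i | 0 < (hH x₀).eigenvalues i} ≤ #{i | 0 < (hH y).eigenvalues i} := by
  classical
  set Sp : Finset m := {i | 0 < (hH x₀).eigenvalues i} with hSp
  rcases Sp.eq_empty_or_nonempty with hSe | hSne
  · simp only [hSe, Finset.card_empty, zero_le, Filter.eventually_true]
  obtain ⟨i₀, hi₀, hmin⟩ := Sp.exists_min_image (fun i ↦ (hH x₀).eigenvalues i) hSne
  set c : ℝ := (hH x₀).eigenvalues i₀ with hc
  have hcpos : 0 < c := by
    have : i₀ ∈ Sp := hi₀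
    rw [hSp, Finset.mem_filter] at this
    exact this.2
  let E : Submodule ℂ (EuclideanSpace ℂ m) :=
    Submodule.span ℂ (Set.range fun i : Sp ↦ (hH x₀).eigenvectorBasis i)
  have hdim : finrank ℂ E = #Sp := finrank_eigSpan (hH x₀) Sp
  have hform : ∀ v ∈ E, c * ‖v‖ ^ 2 ≤ RCLike.re ⟪v, toEuclideanLin (G x₀) v⟫_ℂ :=
    fun v hv ↦ mul_norm_sq_le_re_inner_of_mem_eigSpan (hH x₀) (S := Sp) (fun i hi ↦ hmin i hi) hv
  filter_upwards [eventually_opNorm_sub_lt hG x₀ (half_pos hcpos)] with y hy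
  rw [← hdim]
  refine finrank_le_card_lt_eigenvalues (hH y) E fun v hv hv0 ↦ ?_
  rw [zero_mul, re_inner_split (G x₀) (G y) v]
  have h1 := hform v hv
  have h2 := abs_re_inner_le_opNorm_mul (Matrix.toEuclideanCLM (n := m) (𝕜 := ℂ) (G y - G x₀)) v
  have h3 := neg_abs_le (RCLike.re ⟪v, (Matrix.toEuclideanCLM (n := m) (𝕜 := ℂ) (G y - G x₀)) v⟫_ℂ)
  have hv2 : 0 < ‖v‖ ^ 2 := pow_pos (norm_pos_iff.2 hv0) 2
  nlinarith

/-- **Lower semicontinuity of the negative count.** For a continuous family of Hermitian matrices,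
`ν₋(G(x₀)) ≤ ν₋(G(y))` for all `y` near `x₀`. [cite: GolubVanLoan2013, §8.1.1 Thm 8.1.2 (Courant–Fischer Minimax Theorem)] -/
theorem eventually_card_neg_eigenvalues_le {G : X → Matrix m m ℂ} (hG : Continuous G)
    (hH : ∀ x, (G x).IsHermitian) (x₀ : X) :
    ∀ᶠ y in nhds x₀, #{i | (hH x₀).eigenvalues i < 0} ≤ #{i | (hH y).eigenvalues i < 0} := by
  classical
  set Sn : Finset m := {i | (hH x₀).eigenvalues i < 0} with hSn
  rcases Sn.eq_empty_or_nonempty with hSe | hSne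
  · simp only [hSe, Finset.card_empty, zero_le, Filter.eventually_true]
  obtain ⟨i₀, hi₀, hmax⟩ := Sn.exists_max_image (fun i ↦ (hH x₀).eigenvalues i) hSne
  set c : ℝ := (hH x₀).eigenvalues i₀ with hc
  have hcneg : c < 0 := by
    have : i₀ ∈ Sn := hi₀
    rw [hSn, Finset.mem_filter] at this
    exact this.2
  let E : Submodule ℂ (EuclideanSpace ℂ m) :=
    Submodule.span ℂ (Set.range fun i : Sn ↦ (hH x₀).eigenvectorBasis i)
  have hdim : finrank ℂ E = #Sn := finrank_eigSpan (hH x₀) Sn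
  have hform : ∀ v ∈ E, RCLike.re ⟪v, toEuclideanLin (G x₀) v⟫_ℂ ≤ c * ‖v‖ ^ 2 :=
    fun v hv ↦ re_inner_le_mul_norm_sq_of_mem_eigSpan (hH x₀) (S := Sn) (fun i hi ↦ hmax i hi) hv
  filter_upwards [eventually_opNorm_sub_lt hG x₀ (half_pos (neg_pos.2 hcneg))] with y hy
  rw [← hdim]
  refine finrank_le_card_eigenvalues_lt (hH y) E fun v hv hv0 ↦ ?_
  rw [zero_mul, re_inner_split (G x₀) (G y) v]
  have h1 := hform v hv
  have h2 := abs_re_inner_le_opNorm_mul (Matrix.toEuclideanCLM (n := m) (𝕜 := ℂ) (G y - G x₀)) v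
  have h3 := le_abs_self (RCLike.re ⟪v, (Matrix.toEuclideanCLM (n := m) (𝕜 := ℂ) (G y - G x₀)) v⟫_ℂ)
  have hv2 : 0 < ‖v‖ ^ 2 := pow_pos (norm_pos_iff.2 hv0) 2
  nlinarith

/-- Trichotomy count for the eigenvalues of a Hermitian matrix. [folklore] -/
private theorem card_pos_add_card_neg_add_card_zero {A : Matrix m m ℂ} (hA : A.IsHermitian) :
    #{i | 0 < hA.eigenvalues i} + #{i | hA.eigenvalues i < 0} + #{i | hA.eigenvalues i = 0}
      = Fintype.card m := by
  have h1 : #{i | 0 < hA.eigenvalues i} + #({i | ¬ 0 < hA.eigenvalues i} : Finset m) = Fintype.card m := by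
    rw [Finset.card_filter_add_card_filter_not, Finset.card_univ]
  have h2 : #({i | ¬ 0 < hA.eigenvalues i} : Finset m)
      = #{i | hA.eigenvalues i < 0} + #{i | hA.eigenvalues i = 0} := by
    rw [← Finset.card_union_of_disjoint]
    · congr 1
      ext i
      simp only [Finset.mem_filter, Finset.mem_univ, true_and, Finset.mem_union, not_lt]
      constructor
      · intro h; exact h.lt_or_eq
      · rintro (h | h); exact h.le; exact h.le
    · rw [Finset.disjoint_filter]
      intro i _ h1 h2
      rw [h2] at h1; exact lt_irrefl _ h1
  omega

/-- **The inertia of a continuous family of nonsingular Hermitian matrices is constant on a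
preconnected set.** If `G : X → Matrix m m ℂ` is continuous, every `G(x)` is Hermitian, and for
`x ∈ S` (preconnected) no eigenvalue of `G(x)` vanishes, then the number of positive eigenvalues and
the number of negative eigenvalues of `G(x)` are the same for all `x ∈ S`.
[cite: GolubVanLoan2013, §8.1.1 Thm 8.1.2 (Courant–Fischer Minimax Theorem); CarlsonSchneider1962, § 1] -/
theorem card_pos_eigenvalues_eq_of_isPreconnected {G : X → Matrix m m ℂ} (hG : Continuous G)
    (hH : ∀ x, (G x).IsHermitian) {S : Set X} (hS : IsPreconnected S)
    (h0 : ∀ x ∈ S, #{i | (hH x).eigenvalues i = 0} = 0) {x y : X} (hx : x ∈ S) (hy : y ∈ S) :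
    #{i | 0 < (hH x).eigenvalues i} = #{i | 0 < (hH y).eigenvalues i} ∧
      #{i | (hH x).eigenvalues i < 0} = #{i | (hH y).eigenvalues i < 0} := by
  classical
  -- the sum of the two counts on `S`
  have hsum : ∀ z ∈ S, #{i | 0 < (hH z).eigenvalues i} + #{i | (hH z).eigenvalues i < 0} = Fintype.card m :=
    fun z hz ↦ by
      have := card_pos_add_card_neg_add_card_zero (hH z)
      rw [h0 z hz, add_zero] at this
      exact this
  -- local constancy of the positive count on `S`
  let a : X → ℕ := fun x ↦ #{i | 0 < (hH x).eigenvalues i}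
  have hloc : ∀ z ∈ S, ∀ᶠ w in nhdsWithin z S, a w = a z := by
    intro z hz
    have h1 := eventually_card_pos_eigenvalues_le hG hH z
    have h2 := eventually_card_neg_eigenvalues_le hG hH z
    have h3 : ∀ᶠ w in nhdsWithin z S, w ∈ S := eventually_mem_nhdsWithin
    filter_upwards [nhdsWithin_le_nhds h1, nhdsWithin_le_nhds h2, h3] with w hw1 hw2 hw3
    have hz' := hsum z hz; have hw' := hsum w hw3
    show #{i | 0 < (hH w).eigenvalues i} = #{i | 0 < (hH z).eigenvalues i}
    omega
  have hcont : ContinuousOn a S := fun z hz ↦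
    (continuousWithinAt_const (b := a z)).congr_of_eventuallyEq (hloc z hz) rfl
  have ha : #{i | 0 < (hH x).eigenvalues i} = #{i | 0 < (hH y).eigenvalues i} := hS.constant hcont hx hy
  refine ⟨ha, ?_⟩
  have hx' := hsum x hx; have hy' := hsum y hy
  omega

end Literature.LinearAlgebra.Matrix
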